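import Literature.MathematicalPhysics.KineticTheory.VelocityFlipNoise
import Summits.AtomisticToContinuum.FouriersLaw.Theorems.OddResponseBound.Negative.OddPairing

/-!
# The contact-momenta flip: equal-time decorrelation of the two contact currents and the pairing bound

Helper (`--supports`) for the line `contact-current-forgetting` of the crux `JunctionLocality.NonBallistic`
(stmt-AtomisticToContinuum-9127), stub `stub_lightConeWindow` (LC): the STATIC (`t = 0`) content of the
light-cone window and the symmetry reduction of its dynamic content to a flow-sensitivity statement.

For a chain `P : OscillatorChain` with `N` sites let `Θ₀₁ = (·)^{0} ∘ (·)^{1}` be the flip of the two CONTACT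
momenta `p₀, p₁` (composite of two Bernardin–Olla single-site flips `momentumFlip`, `VelocityFlipNoise.lean`).
It is an involution (`momentumFlip_comm`, `contactFlip_involutive`), measurable, and preserves every Gibbs
measure `μ_T = Z⁻¹e^{-H/T} dq dp` (`measurePreserving_contactFlip_gibbsMeasure`). The contact current
`j₀ = -½(p₀ + p₁)V'(q₁ - q₀)` is ODD under `Θ₀₁` (`bondCurrent_zero_contactFlip`) while every bond current
`j_k`, `k ≥ 2`, is EVEN (`bondCurrent_contactFlip_of_two_le`). Consequences (the odd-pairing calculus of
`OddResponseBound/Negative/OddPairing.lean` with `Θ = Θ₀₁`, `g = j₀`):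
* `∫ j₀ · (h ∘ Θ₀₁) dμ_T = -∫ j₀ · h dμ_T` for every `h` (`integral_bondCurrent_zero_mul_comp_contactFlip`), so
  every `Θ₀₁`-invariant observable is `μ_T`-orthogonal to `j₀` (`integral_bondCurrent_zero_mul_eq_zero_of_contactFlip`)
  — "`j₀` is odd in `(p₀,p₁)` against independent centred momenta";
* in particular the two contact currents are uncorrelated at equal times as soon as they share no site:
  `∫ j₀ · j_k dμ_T = 0` for `2 ≤ k` (`integral_bondCurrent_zero_mul_bondCurrent_eq_zero`; `k = N - 2`, `N ≥ 4`:
  the `t = 0` value of the extreme Green–Kubo entry `M_N(0,N-2)` vanishes exactly);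
* the PAIRING BOUND `4 (∫ j₀ h dμ_T)² ≤ (∫ j₀² dμ_T) · ∫ (h - h∘Θ₀₁)² dμ_T` for `j₀, h ∈ L²(μ_T)`
  (`four_mul_sq_integral_bondCurrent_zero_mul_le`): with `h = κ_t j_{N-2}` (the far contact current evolved by
  the equal-temperature kernels) it reduces the light cone `M_N(0,N-2)(t) → 0` to the `L²(μ_T)`-insensitivity
  of `κ_t j_{N-2}` to flipping the near contact momenta at time `0` (synchronous coupling of the two flows).
-/

noncomputable section

open MeasureTheory

namespace Summit.AtomisticToContinuum.FouriersLaw.Theorems.NonBallistic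

open Literature.MathematicalPhysics.KineticTheory.HeatConduction
open Summit.AtomisticToContinuum.FouriersLaw.Theorems.OddResponseBound.Negative.OddPairing

variable {N : ℕ}

/-- Single-site momentum flips commute. [folklore] -/
theorem momentumFlip_comm (i j : Fin N) (x : PhaseSpace N) :
    momentumFlip i (momentumFlip j x) = momentumFlip j (momentumFlip i x) := by
  by_cases hij : i = j
  · subst hij
    rfl
  refine Prod.ext rfl (funext fun k => ?_)
  by_cases hki : k = i
  · subst hki
    rw [momentumFlip_snd_self, momentumFlip_snd_of_ne hij, momentumFlip_snd_of_ne hij,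
      momentumFlip_snd_self]
  · by_cases hkj : k = j
    · subst hkj
      rw [momentumFlip_snd_of_ne hki, momentumFlip_snd_self, momentumFlip_snd_self,
        momentumFlip_snd_of_ne hki]
    · rw [momentumFlip_snd_of_ne hki, momentumFlip_snd_of_ne hkj, momentumFlip_snd_of_ne hkj,
        momentumFlip_snd_of_ne hki]

/-- A two-site momentum flip is an involution. [folklore] -/
theorem contactFlip_involutive (i i' : Fin N) :
    Function.Involutive fun x : PhaseSpace N => momentumFlip i (momentumFlip i' x) := by
  intro x
  simp only
  rw [momentumFlip_comm i i' (momentumFlip i (momentumFlip i' x)), momentumFlip_momentumFlip,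
    momentumFlip_momentumFlip]

/-- A two-site momentum flip is measurable. [folklore] -/
theorem measurable_contactFlip (i i' : Fin N) :
    Measurable fun x : PhaseSpace N => momentumFlip i (momentumFlip i' x) :=
  (measurable_momentumFlip i).comp (measurable_momentumFlip i')

/-- A two-site momentum flip preserves every Gibbs measure. [folklore] -/
theorem measurePreserving_contactFlip_gibbsMeasure (P : OscillatorChain) (N : ℕ) (T : ℝ) (i i' : Fin N) :
    MeasurePreserving (fun x : PhaseSpace N => momentumFlip i (momentumFlip i' x))
      (P.gibbsMeasure N T) (P.gibbsMeasure N T) :=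
  (P.measurePreserving_momentumFlip_gibbsMeasure N T i).comp (P.measurePreserving_momentumFlip_gibbsMeasure N T i')

/-- The contact current `j₀ = -½(p₀ + p₁)V'(q₁ - q₀)` is odd under the flip of the two contact momenta.
[folklore] -/
theorem bondCurrent_zero_contactFlip (P : OscillatorChain) (i i' : Fin N) (hi : (i : ℕ) = 0)
    (hi' : (i' : ℕ) = 1) (x : PhaseSpace N) :
    P.bondCurrent N i (momentumFlip i (momentumFlip i' x)) = -P.bondCurrent N i x := by
  have hne : i ≠ i' := fun h => by rw [h] at hi; omega
  have hne' : i' ≠ i := fun h => hne h.symm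
  simp only [OscillatorChain.bondCurrent, momentumFlip_fst, ← Finset.sum_neg_distrib]
  refine Finset.sum_congr rfl fun j _ => ?_
  by_cases h : (j : ℕ) = (i : ℕ) + 1
  · have hj : j = i' := Fin.ext (by omega)
    subst hj
    rw [if_pos h, if_pos h, momentumFlip_snd_self, momentumFlip_snd_of_ne hne, momentumFlip_snd_of_ne hne',
      momentumFlip_snd_self]
    ring
  · rw [if_neg h, if_neg h, neg_zero]

/-- A bond current `j_k` with `k ≥ 2` does not see the contact momenta: it is invariant under their flip.
[folklore] -/
theorem bondCurrent_contactFlip_of_two_le (P : OscillatorChain) (i i' k : Fin N) (hi : (i : ℕ) = 0)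
    (hi' : (i' : ℕ) = 1) (hk : 2 ≤ (k : ℕ)) (x : PhaseSpace N) :
    P.bondCurrent N k (momentumFlip i (momentumFlip i' x)) = P.bondCurrent N k x := by
  have hki : k ≠ i := fun h => by rw [h] at hk; omega
  have hki' : k ≠ i' := fun h => by rw [h] at hk; omega
  simp only [OscillatorChain.bondCurrent, momentumFlip_fst]
  refine Finset.sum_congr rfl fun j _ => ?_
  by_cases h : (j : ℕ) = (k : ℕ) + 1
  · have hji : j ≠ i := fun h' => by rw [h'] at h; omega
    have hji' : j ≠ i' := fun h' => by rw [h'] at h; omega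
    rw [if_pos h, if_pos h, momentumFlip_snd_of_ne hki, momentumFlip_snd_of_ne hki',
      momentumFlip_snd_of_ne hji, momentumFlip_snd_of_ne hji']
  · rw [if_neg h, if_neg h]

/-- **Flip antisymmetry.** For every observable `h` (no integrability needed),
`∫ j₀ · (h ∘ Θ₀₁) dμ_T = -∫ j₀ · h dμ_T`. [folklore] -/
theorem integral_bondCurrent_zero_mul_comp_contactFlip (P : OscillatorChain) (T : ℝ) (i i' : Fin N)
    (hi : (i : ℕ) = 0) (hi' : (i' : ℕ) = 1) (h : PhaseSpace N → ℝ) :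
    ∫ x, P.bondCurrent N i x * h (momentumFlip i (momentumFlip i' x)) ∂(P.gibbsMeasure N T) =
      -∫ x, P.bondCurrent N i x * h x ∂(P.gibbsMeasure N T) :=
  integral_mul_comp_eq_neg (measurePreserving_contactFlip_gibbsMeasure P N T i i')
    (measurable_contactFlip i i') (contactFlip_involutive i i') (bondCurrent_zero_contactFlip P i i' hi hi')

/-- **Orthogonality to flip-invariant observables**: if `h ∘ Θ₀₁ = h` then `∫ j₀ · h dμ_T = 0`. [folklore] -/
theorem integral_bondCurrent_zero_mul_eq_zero_of_contactFlip (P : OscillatorChain) (T : ℝ) (i i' : Fin N)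
    (hi : (i : ℕ) = 0) (hi' : (i' : ℕ) = 1) (h : PhaseSpace N → ℝ)
    (hh : ∀ x, h (momentumFlip i (momentumFlip i' x)) = h x) :
    ∫ x, P.bondCurrent N i x * h x ∂(P.gibbsMeasure N T) = 0 := by
  have key := integral_bondCurrent_zero_mul_comp_contactFlip P T i i' hi hi' h
  simp only [hh] at key
  linarith

/-- **Equal-time decorrelation of the contact currents.** For the bonds `0` and `k ≥ 2` (e.g. `k = N - 2`,
`N ≥ 4`): `∫ j₀ · j_k dμ_T = 0`. [folklore] -/
theorem integral_bondCurrent_zero_mul_bondCurrent_eq_zero :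
    ∀ (P : OscillatorChain) (N : ℕ) (T : ℝ) (i k : Fin N), (i : ℕ) = 0 → 2 ≤ (k : ℕ) →
      ∫ x, P.bondCurrent N i x * P.bondCurrent N k x ∂(P.gibbsMeasure N T) = 0 := by
  intro P N T i k hi hk
  have h1 : 1 < N := by have := k.isLt; omega
  exact integral_bondCurrent_zero_mul_eq_zero_of_contactFlip P T i ⟨1, h1⟩ hi rfl _
    (bondCurrent_contactFlip_of_two_le P i ⟨1, h1⟩ k hi rfl hk)

/-- **Pairing bound** (synchronous-coupling reduction of the light cone): for `j₀, h ∈ L²(μ_T)`,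
`4 (∫ j₀ h dμ_T)² ≤ (∫ j₀² dμ_T) · ∫ (h - h ∘ Θ₀₁)² dμ_T`. [folklore] -/
theorem four_mul_sq_integral_bondCurrent_zero_mul_le (P : OscillatorChain) (T : ℝ) (i i' : Fin N)
    (hi : (i : ℕ) = 0) (hi' : (i' : ℕ) = 1) {h : PhaseSpace N → ℝ}
    (hj : MemLp (P.bondCurrent N i) 2 (P.gibbsMeasure N T)) (hh : MemLp h 2 (P.gibbsMeasure N T)) :
    4 * (∫ x, P.bondCurrent N i x * h x ∂(P.gibbsMeasure N T)) ^ 2 ≤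
      (∫ x, P.bondCurrent N i x ^ 2 ∂(P.gibbsMeasure N T)) *
        ∫ x, (h x - h (momentumFlip i (momentumFlip i' x))) ^ 2 ∂(P.gibbsMeasure N T) :=
  four_mul_sq_integral_le (measurePreserving_contactFlip_gibbsMeasure P N T i i')
    (measurable_contactFlip i i') (contactFlip_involutive i i') (bondCurrent_zero_contactFlip P i i' hi hi') hj hh

end Summit.AtomisticToContinuum.FouriersLaw.Theorems.NonBallistic

end
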